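import Literature.Computability.AlgebraicComplexity.CohnUmansTPP
import Mathlib.GroupTheory.Complement
import Mathlib.Data.Set.Card

/-!
# ω-census tool: a subgroup realizing `⟨n, m, p⟩` makes the whole group realize `⟨[G:H]·n, m, p⟩`

HONEST FRAMING (pub-omega census; verbatim): lottery ticket; floor = certified bounds/negative ranges.  Census BOOKKEEPING
(family (b), pub-omega stpp-1 gen 15, prereg P-031.8 mechanism note): the right-transversal lifting of a TPP triple; nothing
here is progress on `ω`.

**Lemma (`realizesTPP_index_mul_of_subgroup`).** Let `H ≤ G` be a subgroup of a finite group and suppose `H` realizes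
`⟨n, m, p⟩` through `S, T, U ⊆ H`.  Let `R` be a right transversal of `H` (`G = ⊔_{r ∈ R} H r`, `|R| = [G:H]`).  Then
`S·R = {s r}`, `T`, `U` realize `⟨[G:H]·n, m, p⟩` in `G`: if `(s r)(s' r')⁻¹ (t t'⁻¹)(u u'⁻¹) = 1` then
`r r'⁻¹ ∈ H`, so `r = r'` (transversal), and the equation becomes `s s'⁻¹ (t t'⁻¹)(u u'⁻¹) = 1` inside `H`.  This
strengthens the index-free transport `RealizesTPP.of_subgroup` and is the subgroup counterpart of Cohn–Umans' Lemma 2.2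
for normal subgroups (`CohnUmans2003_lemma22`: `N` realizing `⟨n₁,n₂,n₃⟩` and `G/N` realizing `⟨m₁,m₂,m₃⟩` give
`⟨n₁m₁, n₂m₂, n₃m₃⟩`).  Example: `S₃ ≤ S₄` realizes `⟨2,2,2⟩`, hence `S₄` realizes `⟨8,2,2⟩`.  For the census it says that
the ratio "best TPP volume with two fixed small sides / |G|" never decreases from a subgroup to the group (used in the cell's
P-031.8 note: a census-useful class of groups must be closed under taking sections).
-/

namespace Summit.MatrixMultiplication.OmegaCensus

open Literature.Computability.AlgebraicComplexity

variable {G : Type*} [Group G]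

/-- **Subgroup-index lifting of a TPP triple.** If a subgroup `H` of a finite group `G` realizes `⟨n, m, p⟩`, then
`G` realizes `⟨[G:H]·n, m, p⟩` (through `S·R, T, U` for a right transversal `R` of `H`). [folklore] -/
theorem realizesTPP_index_mul_of_subgroup [Finite G] (H : Subgroup G) {n m p : ℕ}
    (h : RealizesTPP H n m p) : RealizesTPP G (H.index * n) m p := by
  classical
  obtain ⟨S, T, U, hS, hT, hU, htpp⟩ := h
  obtain ⟨R, hR, -⟩ := H.exists_isComplement_right 1
  have hRfin : R.Finite := Set.toFinite R
  have memRf : ∀ r, r ∈ hRfin.toFinset ↔ r ∈ R := fun r => Set.Finite.mem_toFinset hRfin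
  have cardRf : hRfin.toFinset.card = H.index := by
    rw [← hR.ncard_right, Set.ncard_eq_toFinset_card R hRfin]
  -- uniqueness of the decomposition `g = h r` (`h ∈ H`, `r ∈ R`)
  have uniq : ∀ (h₁ h₂ : G) (r₁ r₂ : G), h₁ ∈ H → h₂ ∈ H → r₁ ∈ R → r₂ ∈ R →
      h₁ * r₁ = h₂ * r₂ → h₁ = h₂ ∧ r₁ = r₂ := by
    intro h₁ h₂ r₁ r₂ hh₁ hh₂ hr₁ hr₂ heq
    have := @hR.1 (⟨h₁, hh₁⟩, ⟨r₁, hr₁⟩) (⟨h₂, hh₂⟩, ⟨r₂, hr₂⟩) (by simpa using heq)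
    simp only [Prod.mk.injEq, Subtype.mk.injEq] at this
    exact this
  let emb : ↥H ↪ G := ⟨Subtype.val, Subtype.val_injective⟩
  refine ⟨(S ×ˢ hRfin.toFinset).image (fun x => (x.1 : G) * x.2), T.map emb, U.map emb, ?_,
    by rw [Finset.card_map, hT], by rw [Finset.card_map, hU], ?_⟩
  · -- the lifted set has `[G:H]·n` elements
    rw [Finset.card_image_of_injOn, Finset.card_product, hS, cardRf, Nat.mul_comm]
    rintro ⟨a, r⟩ har ⟨a', r'⟩ har' (heq : (a : G) * r = (a' : G) * r')
    simp only [Finset.coe_product, Set.mem_prod, Finset.mem_coe, memRf] at har har'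
    obtain ⟨h1, h2⟩ := uniq a a' r r' a.2 a'.2 har.2 har'.2 heq
    exact Prod.ext (Subtype.ext h1) h2
  · -- the triple product property
    intro s₁ hs₁ s₂ hs₂ t ht t' ht' u hu u' hu' heq
    obtain ⟨⟨a, r⟩, har, rfl⟩ := Finset.mem_image.1 hs₁
    obtain ⟨⟨a', r'⟩, har', rfl⟩ := Finset.mem_image.1 hs₂
    obtain ⟨b, hb, rfl⟩ := Finset.mem_map.1 ht
    obtain ⟨b', hb', rfl⟩ := Finset.mem_map.1 ht'
    obtain ⟨c, hc, rfl⟩ := Finset.mem_map.1 hu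
    obtain ⟨c', hc', rfl⟩ := Finset.mem_map.1 hu'
    simp only [Finset.mem_product, memRf] at har har'
    simp only [Function.Embedding.coeFn_mk, emb] at heq ⊢
    -- the word of `H` hidden in the equation
    set k : ↥H := b * b'⁻¹ * (c * c'⁻¹) with hk
    have hkG : (k : G) = (b : G) * (b' : G)⁻¹ * ((c : G) * (c' : G)⁻¹) := by simp [hk]
    have heq' : (a : G) * r * ((a' : G) * r')⁻¹ * (k : G) = 1 := by
      rw [hkG]; simpa only [mul_assoc] using heq
    have hX : (a : G) * r * ((a' : G) * r')⁻¹ = (k : G)⁻¹ := eq_inv_of_mul_eq_one_left heq'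
    have hr : r = (a : G)⁻¹ * (k : G)⁻¹ * (a' : G) * r' := by
      have : r = ((a : G)⁻¹) * ((a : G) * r * ((a' : G) * r')⁻¹) * ((a' : G) * r') := by group
      rw [hX] at this; simpa only [mul_assoc] using this
    -- transversal uniqueness: `r = r'`
    have hmem : (a : G)⁻¹ * (k : G)⁻¹ * (a' : G) ∈ H :=
      H.mul_mem (H.mul_mem (H.inv_mem a.2) (H.inv_mem k.2)) a'.2
    obtain ⟨-, hrr⟩ := uniq 1 ((a : G)⁻¹ * (k : G)⁻¹ * (a' : G)) r r' H.one_mem hmem har.2 har'.2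
      (by rw [one_mul]; exact hr)
    subst hrr
    -- now it is `H`'s own equation
    have hH : ((a * a'⁻¹ * (b * b'⁻¹) * (c * c'⁻¹) : ↥H) : G) = 1 := by
      have h1 : (a : G) * r * ((a' : G) * r)⁻¹ = (a : G) * (a' : G)⁻¹ := by group
      have := heq; rw [h1] at this; simpa using this
    have hH' : a * a'⁻¹ * (b * b'⁻¹) * (c * c'⁻¹) = (1 : ↥H) := Subtype.ext (by simpa using hH)
    obtain ⟨h1, h2, h3⟩ := htpp a har.1 a' har'.1 b hb b' hb' c hc c' hc' hH'
    subst h1 h2 h3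
    exact ⟨rfl, rfl, rfl⟩

end Summit.MatrixMultiplication.OmegaCensus
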